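import Literature.NumberTheory.ConnesMoscovici2022.UVProlateMaxDomainRegularity
import Literature.NumberTheory.ConnesMoscovici2022.UVProlateMaxDomainEndpoints

/-!
# RH-FREE. Connes–Moscovici 2022, §1: the boundary condition (1.19) on the regular representative,
# and the vanishing of the `±λ` boundary terms for elements of `𝓛_β = dom W_sa`

LINE 1 FRAMING: RH-FREE corpus literature (cell rh-crit, C1 Connes–Consani/Moscovici corpus, row O2
`UVProlateSpectrum`; regular-singular-endpoint bookkeeping for `W_λ = −∂ₓ(λ² − x²)∂ₓ + (2πλx)²`).
bears_on: W-C/W-P only (sequel material, no leaf role).  WHAT THIS IS NOT: nothing here bears on the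
truth of RH; no statement about zeta zeros; theorems only (0 defs, 0 named facts); `CM22_thm_1_6`
stays a named fact.

## What is proved — the `±λ` half of the Green/Lagrange boundary bookkeeping for Thm 1.6 (i)/(ii)

`dom W_sa` is typed (`prolateSASet`) through a representative `g₀` that is merely differentiable off
`±λ` and satisfies (1.19) `p g₀′ → 0` at `±λ` (within `ℝ ∖ {±λ}`).  The companion modules give, for
every `ξ ∈ dom W_max`, a REGULAR representative `g` (`exists_regular_repr`: `C¹` off `±λ`, `p g′` a
primitive of `q g − W_max ξ`) and one-sided limits of such `g` under (1.19)
(`exists_tendsto_…_of_ftc`).  Here: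

* `bc_transfer` — (1.19) passes from `g₀` to `g` (they agree off `±λ`, so do their derivatives), as
  the four one-sided statements `p g′ → 0` at `λ±`, `(−λ)±`;
* `exists_regular_repr_of_mem_prolateSASet` — for `ξ ∈ 𝓛_β`: ONE representative `g` with all the
  conclusions of `exists_regular_repr`, the four one-sided (1.19) limits, and the four one-sided limits
  of `g` itself (continuity up to `±λ` from each side);
* `tendsto_boundaryForm_zero` — for two such pairs `(g₁, η₁)`, `(g₂, η₂)` the Lagrange boundary form
  `ḡ₁·(p g₂′) − (p ḡ₁′)·g₂` tends to `0` along each of the four one-sided filters at `±λ` (pure filter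
  algebra from the previous two items): these are the `±λ` boundary terms in the printed proofs of
  Thm 1.6 (i) (symmetry of `W_sa`) and (ii) (`[W, P_λ] = 0`), «the boundary terms vanish because of
  condition (1.19)».

Source: [ConnesMoscovici2022] = arXiv:2112.05500v1, Definition before Thm 2.6 and proof of Thm 2.6
(chunk p0006:L52–L114).  Cell rh-crit seat cc-t6 g4 (cut of record cc/STATUS R135 (2): stage (D-fin)).
-/

noncomputable section

open Complex Set MeasureTheory Filter Topology intervalIntegral
open scoped Real Topology ContDiff

namespace Literature.NumberTheory.ConnesMoscovici2022

open Literature.NumberTheory.ConnesConsani2021 Literature.NumberTheory.ConnesConsani2024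

variable {lam : ℝ}

/-! ## §1. (1.19) transfers from the `ProlateBC` representative to the regular representative -/

/-- The one-sided filters at `±λ` are finer than `𝓝[ℝ ∖ {±λ}]`. [folklore] -/
private theorem nhdsGT_le_nhdsWithin_U (hlam : 0 < lam) {a : ℝ} (ha : a = lam ∨ a = -lam) :
    𝓝[>] a ≤ 𝓝[{x : ℝ | x ≠ lam ∧ x ≠ -lam}] a := by
  refine nhdsWithin_le_iff.2 (mem_of_superset (Ioo_mem_nhdsGT (show a < a + lam by linarith)) ?_)
  intro x hx
  rcases ha with rfl | rfl
  · exact ⟨hx.1.ne', by linarith [hx.1]⟩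
  · exact ⟨by linarith [hx.2], hx.1.ne'⟩

/-- The one-sided filters at `±λ` are finer than `𝓝[ℝ ∖ {±λ}]`. [folklore] -/
private theorem nhdsLT_le_nhdsWithin_U (hlam : 0 < lam) {a : ℝ} (ha : a = lam ∨ a = -lam) :
    𝓝[<] a ≤ 𝓝[{x : ℝ | x ≠ lam ∧ x ≠ -lam}] a := by
  refine nhdsWithin_le_iff.2 (mem_of_superset (Ioo_mem_nhdsLT (show a - lam < a by linarith)) ?_)
  intro x hx
  rcases ha with rfl | rfl
  · exact ⟨hx.2.ne, by linarith [hx.1]⟩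
  · exact ⟨by linarith [hx.2], hx.2.ne⟩

/-- RH-FREE (PROVED). **(1.19) transfers to the regular representative.** If `g₀ = g` a.e., `g₀` is
differentiable off `±λ`, `g` is `C¹` off `±λ`, and `p g₀′ → 0` at `a ∈ {±λ}` within `ℝ ∖ {±λ}` (the
`ProlateBC` field), then `p g′ → 0` at `a` from the right and from the left.
[cite: ConnesMoscovici2022, §1 boundary condition (1.19) (= arXiv (2.19), chunk p0006:L55–L60)] -/
theorem bc_transfer (hlam : 0 < lam) {g₀ g : ℝ → ℂ} (h : g₀ =ᵐ[volume] g)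
    (hd₀ : DifferentiableOn ℝ g₀ {x | x ≠ lam ∧ x ≠ -lam})
    (hg : ContDiffOn ℝ 1 g {x | x ≠ lam ∧ x ≠ -lam}) {a : ℝ} (ha : a = lam ∨ a = -lam)
    (h₀ : Tendsto (fun x ↦ pCoeff lam x * deriv g₀ x) (𝓝[{x | x ≠ lam ∧ x ≠ -lam}] a) (𝓝 0)) :
    Tendsto (fun x ↦ pCoeff lam x * deriv g x) (𝓝[>] a) (𝓝 0) ∧
      Tendsto (fun x ↦ pCoeff lam x * deriv g x) (𝓝[<] a) (𝓝 0) := by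
  set U : Set ℝ := {x | x ≠ lam ∧ x ≠ -lam} with hU
  have hUo : IsOpen U := isOpen_ne.and isOpen_ne
  have heq : EqOn g₀ g U := eqOn_of_ae_eq_of_continuousOn h hd₀.continuousOn hg.continuousOn
  have hderiv : EqOn (fun x ↦ pCoeff lam x * deriv g₀ x) (fun x ↦ pCoeff lam x * deriv g x) U := by
    intro x hx
    simp only
    rw [(heq.eventuallyEq_of_mem (hUo.mem_nhds hx)).deriv_eq]
  have hU' : Tendsto (fun x ↦ pCoeff lam x * deriv g x) (𝓝[U] a) (𝓝 0) :=
    h₀.congr' (eventuallyEq_nhdsWithin_of_eqOn hderiv)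
  exact ⟨hU'.mono_left (nhdsGT_le_nhdsWithin_U hlam ha),
    hU'.mono_left (nhdsLT_le_nhdsWithin_U hlam ha)⟩

/-! ## §2. The regular representative of an element of `𝓛_β = dom W_sa` -/

/-- RH-FREE (PROVED). **The regular representative of `ξ ∈ 𝓛_β`.**  For `ξ ∈ prolateSASet λ` there is
ONE function `g` with: `ξ = g` a.e.; `g ∈ C¹(ℝ ∖ {±λ})`; `p g′` a primitive of `q g − W_max ξ` on each
component (FTC form), with the a.e. `HasDerivAt` form; the boundary condition (1.19) in the four
one-sided forms `p g′ → 0` at `λ±`, `(−λ)±`; and the four one-sided limits of `g` itself at `±λ`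
(continuity up to the singular points from each side).
[cite: ConnesMoscovici2022, §1 Definition before Thm 1.6, (1.19) (= arXiv chunk p0006:L52–L60); proof of Lemma 1.2 (= arXiv Lemma 2.2, chunk p0004:L80–L90)] -/
theorem exists_regular_repr_of_mem_prolateSASet (hlam : 0 < lam) {ξ : L2R}
    (hξ : ξ ∈ prolateSASet lam) :
    ∃ g : ℝ → ℂ, ((ξ : ℝ → ℂ)) =ᵐ[volume] g ∧
      ContDiffOn ℝ 1 g {x | x ≠ lam ∧ x ≠ -lam} ∧
      (∀ x y, x ≤ y → Icc x y ⊆ {x | x ≠ lam ∧ x ≠ -lam} →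
        pCoeff lam y * deriv g y - pCoeff lam x * deriv g x =
          ∫ t in x..y, (qCoeff lam t * g t - (prolateMax lam ⟨ξ, hξ.1⟩ : L2R) t)) ∧
      (∀ᵐ x, x ∈ {x : ℝ | x ≠ lam ∧ x ≠ -lam} →
        HasDerivAt (fun y ↦ pCoeff lam y * deriv g y)
          (qCoeff lam x * g x - (prolateMax lam ⟨ξ, hξ.1⟩ : L2R) x) x) ∧
      (∀ a, a = lam ∨ a = -lam →
        Tendsto (fun x ↦ pCoeff lam x * deriv g x) (𝓝[>] a) (𝓝 0) ∧
        Tendsto (fun x ↦ pCoeff lam x * deriv g x) (𝓝[<] a) (𝓝 0)) ∧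
      (∀ a, a = lam ∨ a = -lam →
        (∃ c, Tendsto g (𝓝[>] a) (𝓝 c)) ∧ (∃ c, Tendsto g (𝓝[<] a) (𝓝 c))) := by
  obtain ⟨hdom, g₀, hg₀, hbc⟩ := hξ
  obtain ⟨g, hae, hcd, hftc, hder, -⟩ := exists_regular_repr hlam ⟨ξ, hdom⟩
  have hae' : ((ξ : ℝ → ℂ)) =ᵐ[volume] g := hae
  have h₀g : g₀ =ᵐ[volume] g := hg₀.symm.trans hae'
  have hT : ∀ a, a = lam ∨ a = -lam →
      Tendsto (fun x ↦ pCoeff lam x * deriv g x) (𝓝[>] a) (𝓝 0) ∧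
      Tendsto (fun x ↦ pCoeff lam x * deriv g x) (𝓝[<] a) (𝓝 0) := by
    intro a ha
    rcases ha with rfl | rfl
    · exact bc_transfer hlam h₀g hbc.differentiableOn hcd (Or.inl rfl) hbc.atLam
    · exact bc_transfer hlam h₀g hbc.differentiableOn hcd (Or.inr rfl) hbc.atNegLam
  refine ⟨g, hae', hcd, hftc, hder, hT, ?_⟩
  intro a ha
  set η : L2R := (prolateMax lam ⟨ξ, hdom⟩ : L2R) with hη
  rcases ha with rfl | rfl
  · exact ⟨exists_tendsto_right_lam_of_ftc hlam ξ η hae' hcd hftc (hT _ (Or.inl rfl)).1,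
      exists_tendsto_left_lam_of_ftc hlam ξ η hae' hcd hftc (hT _ (Or.inl rfl)).2⟩
  · exact ⟨exists_tendsto_right_neg_lam_of_ftc hlam ξ η hae' hcd hftc (hT _ (Or.inr rfl)).1,
      exists_tendsto_left_neg_lam_of_ftc hlam ξ η hae' hcd hftc (hT _ (Or.inr rfl)).2⟩

/-! ## §3. The `±λ` boundary terms of the Lagrange/Green identity vanish -/

/-- RH-FREE (PROVED). **Vanishing of the Lagrange boundary form** (abstract filter algebra): if along
a filter `l` one has `g₁ → c₁`, `g₂ → c₂`, `u₁ → 0`, `u₂ → 0` (`uᵢ = p gᵢ′`, (1.19)), then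
`ḡ₁ u₂ − ū₁ g₂ → 0` («the boundary terms vanish because of condition (1.19)»).
[cite: ConnesMoscovici2022, proof of Thm 1.6 (= arXiv Thm 2.6, chunk p0006:L81–L114)] -/
theorem tendsto_boundaryForm_zero {l : Filter ℝ} {g₁ g₂ u₁ u₂ : ℝ → ℂ} {c₁ c₂ : ℂ}
    (hg₁ : Tendsto g₁ l (𝓝 c₁)) (hg₂ : Tendsto g₂ l (𝓝 c₂))
    (hu₁ : Tendsto u₁ l (𝓝 0)) (hu₂ : Tendsto u₂ l (𝓝 0)) :
    Tendsto (fun x ↦ star (g₁ x) * u₂ x - star (u₁ x) * g₂ x) l (𝓝 0) := by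
  have h1 : Tendsto (fun x ↦ star (g₁ x) * u₂ x) l (𝓝 (star c₁ * 0)) :=
    ((continuous_star.tendsto c₁).comp hg₁).mul hu₂
  have h2 : Tendsto (fun x ↦ star (u₁ x) * g₂ x) l (𝓝 (star 0 * c₂)) :=
    ((continuous_star.tendsto (0 : ℂ)).comp hu₁).mul hg₂
  simpa using h1.sub h2

/-- RH-FREE (PROVED). **The four `±λ` boundary terms for two elements of `𝓛_β`.**  For the regular
representatives `g₁, g₂` of `ξ₁, ξ₂ ∈ prolateSASet λ` (any functions with (1.19) in the four one-sided
forms and one-sided limits at `±λ`, as delivered by `exists_regular_repr_of_mem_prolateSASet`), the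
boundary form `ḡ₁·(p g₂′) − (p ḡ₁′)·g₂ = star (g₁)·(p·g₂′) − star (p·g₁′)·g₂` tends to `0` at `λ` and
`−λ` from each side.
[cite: ConnesMoscovici2022, proof of Thm 1.6 (= arXiv Thm 2.6, chunk p0006:L81–L114)] -/
theorem tendsto_boundaryForm_zero_four_sides {g₁ g₂ : ℝ → ℂ}
    (hT₁ : ∀ a, a = lam ∨ a = -lam →
      Tendsto (fun x ↦ pCoeff lam x * deriv g₁ x) (𝓝[>] a) (𝓝 0) ∧
      Tendsto (fun x ↦ pCoeff lam x * deriv g₁ x) (𝓝[<] a) (𝓝 0))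
    (hL₁ : ∀ a, a = lam ∨ a = -lam →
      (∃ c, Tendsto g₁ (𝓝[>] a) (𝓝 c)) ∧ (∃ c, Tendsto g₁ (𝓝[<] a) (𝓝 c)))
    (hT₂ : ∀ a, a = lam ∨ a = -lam →
      Tendsto (fun x ↦ pCoeff lam x * deriv g₂ x) (𝓝[>] a) (𝓝 0) ∧
      Tendsto (fun x ↦ pCoeff lam x * deriv g₂ x) (𝓝[<] a) (𝓝 0))
    (hL₂ : ∀ a, a = lam ∨ a = -lam →
      (∃ c, Tendsto g₂ (𝓝[>] a) (𝓝 c)) ∧ (∃ c, Tendsto g₂ (𝓝[<] a) (𝓝 c)))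
    {a : ℝ} (ha : a = lam ∨ a = -lam) :
    Tendsto (fun x ↦ star (g₁ x) * (pCoeff lam x * deriv g₂ x) -
        star (pCoeff lam x * deriv g₁ x) * g₂ x) (𝓝[>] a) (𝓝 0) ∧
      Tendsto (fun x ↦ star (g₁ x) * (pCoeff lam x * deriv g₂ x) -
        star (pCoeff lam x * deriv g₁ x) * g₂ x) (𝓝[<] a) (𝓝 0) := by
  obtain ⟨⟨c₁, hc₁⟩, ⟨c₁', hc₁'⟩⟩ := hL₁ a ha
  obtain ⟨⟨c₂, hc₂⟩, ⟨c₂', hc₂'⟩⟩ := hL₂ a ha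
  exact ⟨tendsto_boundaryForm_zero hc₁ hc₂ (hT₁ a ha).1 (hT₂ a ha).1,
    tendsto_boundaryForm_zero hc₁' hc₂' (hT₁ a ha).2 (hT₂ a ha).2⟩

end Literature.NumberTheory.ConnesMoscovici2022
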